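/-
Copyright (c) 2026 the pub-hodgecm-mathlib formalisation cell (harness21).  Prover ∕ assembler seat hodgecm-mathlib-LH4-p01 (g17), STAGE 1a «(D-RAM) FOUR-FRAME» squad of
crux H413 (heir LEAD F0P3a-plan T17-31 (R-9) TIER 2; U0_WildTree cand v3 c43d366e904ab2dc row `stub_U0_period_relation_wild`).  2026-09-03.
-/
import Literature.NumberTheory.Automorphic.UnitaryLatticeTreePeriodRelationRamified      -- ★ LH6-p03∕LH5-p04: `natCard_quotient_fixedBy_add_eq_natCard_quotient_fixedBy_inf_three_of_transitive` ((A)(B)(I) as binders)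
import Literature.NumberTheory.Automorphic.UnitaryLatticeTreeRootStarOrbitWild           -- ★ p854659 (this seat): `forall_flag_exists_unitary_of_ramified` (I); brings ★ p854568 htr₀-WILD (A)
import Literature.NumberTheory.Automorphic.UnitaryLatticeTreeTypeTwoTransitiveWild         -- ★ p854569 (LH4-p02): `forall_isVertexLattice_two_exists_mapGL_N₁_eq_of_ramified` (B)
import Literature.NumberTheory.Automorphic.UnitaryThreeFourFrameDefs                       -- ★ #0a: the datum token `IsRamifiedQuadraticDatum σ ϖ d t`
import HarnessLib

/-!
# The lattice graph of a hermitian space — KOTTWITZ'S NON-ELLIPTIC (PERIOD) RELATION ON THE `U(3)` TREE AT EVERY RAMIFIED PLACE, WILD ONES INCLUDED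
# (Kottwitz 1988 §2 Theorem 2; Serre, *Trees* I.6.4; Laumon 1996 Lemma (5.3.2))

Topic `NumberTheory/Automorphic`; namespace `Literature.NumberTheory.Automorphic.UnitaryLatticeTree`.  THEOREMS ONLY (no definition, no instance, no notation, no named fact,
no `sorry`); kernel lane `--supports stmt-HodgeConjecture-24833`.  Cell `pub/hodgecm-mathlib` (D-0151), crux H413; STAGE 1a «(D-RAM) FOUR-FRAME» road, unit U0 (the wild tree),
TIER 2: this file PAYS the tier-1 stub `stub_U0_period_relation_wild` of `Cruxes/H413/Lines/F0_P3c_DyRamFourFrame/U0_WildTree.lean` (§2, statement TOKEN FOR TOKEN).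
The ★ tame file isolates the three transitivity inputs (A) self-dual, (B) type two, (I) flags in `…_of_transitive`; at a wild datum they are ★ p854568 (htr₀-WILD), ★ p854569
(htr₂-WILD) and ★ p854659 (wild edge transitivity) — so the wild relation is their composition (§1).

* §1 **`natCard_quotient_fixedBy_add_eq_natCard_quotient_fixedBy_inf_three_of_ramified`** (conclusion of ★ `…_of_neg` TOKEN FOR TOKEN, tame binders ↦ datum conjuncts).
* §2 **`period_relation_of_isRamifiedQuadraticDatum`** (= `stub_U0_period_relation_wild`'s statement).

HONEST LABEL: HC_CM is proved only modulo the 7 printed citations (2 remaining named inputs: hLiu418 = stmt-HodgeConjecture-24832, h413 = stmt-HodgeConjecture-24833) until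
rung 0 closes; count-neutral support of unit U0.

## References
* [Kottwitz1988] R. E. Kottwitz, *Tamagawa numbers*, Ann. of Math. 127 (1988), §2 Theorem 2 (the non-elliptic relation for Euler–Poincaré functions).
* [Serre1980Trees] J.-P. Serre, *Trees* (1980), I.6.4 Prop. 24–25 (hyperbolic automorphisms and their axes), II.1.1.
* [Laumon1995] G. Laumon, *Cohomology of Drinfeld Modular Varieties* I (1996), Lemma (5.3.2) p. 136.
* [BruhatTits1972] F. Bruhat, J. Tits, *Groupes réductifs sur un corps local I*, Publ. IHÉS 41 (1972), §10.
-/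

set_option autoImplicit false

noncomputable section

open Matrix MulAction SimpleGraph Literature.NumberTheory.Automorphic Literature.Combinatorics.SimpleGraph Literature.GroupTheory
open Literature.NumberTheory.Automorphic.HermitianLattice Literature.NumberTheory.Automorphic.UnitaryGroup Literature.NumberTheory.Automorphic.CartanUnique
open Literature.NumberTheory.Automorphic.UnitaryThreeFourFrame
open scoped Matrix MatrixGroups WithZero Valued Pointwise

namespace Literature.NumberTheory.Automorphic.UnitaryLatticeTree

variable {K : Type*} [Field K] [Valued K ℤᵐ⁰] [ValuativeRel K] [(Valued.v : Valuation K ℤᵐ⁰).Compatible]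

section Wild

variable {σ : K →+* K} {ϖ : K}

/-! ## §1 The non-elliptic relation at a wild datum -/

/-- **KOTTWITZ'S NON-ELLIPTIC RELATION ON THE `U(3)` TREE AT EVERY RAMIFIED PLACE** («PERIOD-G-WILD»): the conclusion of ★ `natCard_quotient_fixedBy_add_eq_natCard_quotient_fixedBy_inf_three_of_neg`
TOKEN FOR TOKEN, its tame binders `(hσϖ hres h2 hnorm)` replaced by the conjuncts of the ramified quadratic datum (`σ`-fixed elements have even valuation, `|ϖ − σϖ| = |ϖ|^d`,
`d ≥ 1`, `|2| = |ϖ|^t`) and a finite residue field — ★ `…_of_transitive` with (A) ★ p854568, (B) ★ p854569, (I) ★ p854659.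
[cite: Kottwitz1988, §2 Theorem 2] [cite: Serre1980Trees, I.6.4 Prop. 24–25; II.1.1] [cite: Laumon1995, Lemma (5.3.2)] [cite: BruhatTits1972, §10] -/
theorem natCard_quotient_fixedBy_add_eq_natCard_quotient_fixedBy_inf_three_of_ramified
    (hσ : ∀ x, σ (σ x) = x) (hvσ : ∀ a, Valued.v (σ a) = Valued.v a) (hϖ : Valued.v ϖ = WithZero.exp (-1 : ℤ))
    (heven : ∀ x : K, σ x = x → x ≠ 0 → ∃ n : ℤ, Valued.v x = WithZero.exp (2 * n)) {d t : ℕ}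
    (hd : Valued.v (ϖ - σ ϖ) = Valued.v ϖ ^ d) (h1d : 1 ≤ d) (h2 : Valued.v (2 : K) = Valued.v ϖ ^ t) [Finite 𝓀[K]]
    (g₁ : GL (Fin 3) K) (hg₁ : (g₁ : Matrix (Fin 3) (Fin 3) K) = Matrix.diagonal ![(1 : K), 1, ϖ])
    {G : Type*} [Group G] (eU : G ≃* ↥(unitaryGroupOfForm σ ((StdForm.antidiagonal 3).over K))) (CA CB CI : Subgroup G)
    (hCA : ∀ g : G, g ∈ CA ↔ ((eU g : ↥(unitaryGroupOfForm σ ((StdForm.antidiagonal 3).over K))) : GL (Fin 3) K) ∈ glInt 3 K)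
    (hCB : ∀ g : G, g ∈ CB ↔ ((eU g : ↥(unitaryGroupOfForm σ ((StdForm.antidiagonal 3).over K))) : GL (Fin 3) K) ∈ (glInt 3 K).map (MulAut.conj g₁).toMonoidHom)
    (hCI : ∀ g : G, g ∈ CI ↔ ((eU g : ↥(unitaryGroupOfForm σ ((StdForm.antidiagonal 3).over K))) : GL (Fin 3) K) ∈ glInt 3 K ∧
      ((eU g : ↥(unitaryGroupOfForm σ ((StdForm.antidiagonal 3).over K))) : GL (Fin 3) K) ∈ (glInt 3 K).map (MulAut.conj g₁).toMonoidHom)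
    (τ γ : G) (hτm : (((eU τ : ↥(unitaryGroupOfForm σ ((StdForm.antidiagonal 3).over K))) : GL (Fin 3) K) : Matrix (Fin 3) (Fin 3) K) = Matrix.diagonal ![ϖ⁻¹, 1, σ ϖ])
    {e : Fin 3 → K} (hγm : (((eU γ : ↥(unitaryGroupOfForm σ ((StdForm.antidiagonal 3).over K))) : GL (Fin 3) K) : Matrix (Fin 3) (Fin 3) K) = Matrix.diagonal e) {c : ℤ}
    (he₀ : Valued.v (e 0) = Valued.v (ϖ ^ c)) (he₁ : Valued.v (e 1) = 1) (he₂ : Valued.v (e 2) = Valued.v (ϖ ^ (-c))) (hτγ : τ * γ = γ * τ)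
    (hfinA : Finite (Quotient ((orbitRel (Subgroup.zpowers (⟨τ, Subgroup.mem_centralizer_singleton_iff.2 hτγ⟩ : Subgroup.centralizer ({γ} : Set G))) (G ⧸ CA)).comap
        (Subtype.val : ↥(fixedBy (G ⧸ CA) γ) → G ⧸ CA))))
    (hfinB : Finite (Quotient ((orbitRel (Subgroup.zpowers (⟨τ, Subgroup.mem_centralizer_singleton_iff.2 hτγ⟩ : Subgroup.centralizer ({γ} : Set G))) (G ⧸ CB)).comap
        (Subtype.val : ↥(fixedBy (G ⧸ CB) γ) → G ⧸ CB)))) :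
    Nat.card (Quotient ((orbitRel (Subgroup.zpowers (⟨τ, Subgroup.mem_centralizer_singleton_iff.2 hτγ⟩ : Subgroup.centralizer ({γ} : Set G))) (G ⧸ CA)).comap
        (Subtype.val : ↥(fixedBy (G ⧸ CA) γ) → G ⧸ CA))) +
      Nat.card (Quotient ((orbitRel (Subgroup.zpowers (⟨τ, Subgroup.mem_centralizer_singleton_iff.2 hτγ⟩ : Subgroup.centralizer ({γ} : Set G))) (G ⧸ CB)).comap
        (Subtype.val : ↥(fixedBy (G ⧸ CB) γ) → G ⧸ CB))) =
    Nat.card (Quotient ((orbitRel (Subgroup.zpowers (⟨τ, Subgroup.mem_centralizer_singleton_iff.2 hτγ⟩ : Subgroup.centralizer ({γ} : Set G))) (G ⧸ CI)).comap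
        (Subtype.val : ↥(fixedBy (G ⧸ CI) γ) → G ⧸ CI))) := by
  have hϖ0 : ϖ ≠ 0 := uniformizer_ne_zero hϖ
  have h20 : (2 : K) ≠ 0 := fun h => by
    rw [h, map_zero] at h2
    exact pow_ne_zero t ((Valuation.ne_zero_iff Valued.v).2 hϖ0) h2.symm
  have hres : ∀ x : K, Valued.v x ≤ 1 → Valued.v (σ x - x) < 1 := fun x hx => v_map_sub_self_lt_one_of_even hσ hϖ heven hd h1d hx
  have hN₁ : mapGL g₁ (stdLattice K 3) = latt (Matrix.diagonal ![(1 : K), 1, ϖ]) := by rw [← hg₁]; rfl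
  have hA : ∀ M : Submodule (Valued.integer K) (Fin 3 → K), IsSelfDualLattice σ ϖ ((StdForm.antidiagonal 3).over K) M →
      ∃ u : ↥(unitaryGroupOfForm σ ((StdForm.antidiagonal 3).over K)), mapGL (u : GL (Fin 3) K) (stdLattice K 3) = M := fun M hM => by
    obtain ⟨u, hu⟩ := exists_unitary_mapGL_stdLattice_eq_of_isSelfDualLattice_of_ramified hσ hvσ hϖ heven hd h1d h2 M hM
    exact ⟨u, hu.symm⟩
  have hB : ∀ M : Submodule (Valued.integer K) (Fin 3 → K), IsVertexLattice σ ϖ ((StdForm.antidiagonal 3).over K) 2 M →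
      ∃ u : ↥(unitaryGroupOfForm σ ((StdForm.antidiagonal 3).over K)), mapGL ((u : GL (Fin 3) K) * g₁) (stdLattice K 3) = M := fun M hM => by
    obtain ⟨u, hu⟩ := forall_isVertexLattice_two_exists_mapGL_N₁_eq_of_ramified hσ hvσ hϖ hres heven h20 M hM
    exact ⟨u, by rw [mapGL_mul, hN₁, hu]⟩
  exact natCard_quotient_fixedBy_add_eq_natCard_quotient_fixedBy_inf_three_of_transitive hσ hvσ hϖ g₁ hg₁ hA hB
    (forall_flag_exists_unitary_of_ramified hσ hvσ hϖ heven hd h1d h2 g₁ hg₁) eU CA CB CI hCA hCB hCI τ γ hτm hγm he₀ he₁ he₂ hτγ hfinA hfinB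

/-! ## §2 The head in the datum token's shape: `stub_U0_period_relation_wild`'s statement -/

/-- **THE NON-ELLIPTIC RELATION ON THE WILD TREE — the statement of the tier-1 stub `stub_U0_period_relation_wild` of `U0_WildTree`, TOKEN FOR TOKEN** (the datum's conjuncts fed
to §1). [cite: Kottwitz1988, §2 Theorem 2] [cite: Serre1980Trees, I.6.4 Prop. 24–25; II.1.1] -/
theorem period_relation_of_isRamifiedQuadraticDatum :
    ∀ {K : Type} [Field K] [Valued K ℤᵐ⁰] [ValuativeRel K] [(Valued.v : Valuation K ℤᵐ⁰).Compatible] [CompleteSpace K] [Fintype 𝓀[K]]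
      (σ : K →+* K) (ϖ : K) (d t : ℕ), IsRamifiedQuadraticDatum σ ϖ d t →
      ∀ (g₁ : GL (Fin 3) K), (g₁ : Matrix (Fin 3) (Fin 3) K) = Matrix.diagonal ![(1 : K), 1, ϖ] →
      ∀ {G : Type} [Group G] (eU : G ≃* ↥(unitaryGroupOfForm σ ((StdForm.antidiagonal 3).over K))) (CA CB CI : Subgroup G),
        (∀ g : G, g ∈ CA ↔ ((eU g : ↥(unitaryGroupOfForm σ ((StdForm.antidiagonal 3).over K))) : GL (Fin 3) K) ∈ glInt 3 K) →
        (∀ g : G, g ∈ CB ↔ ((eU g : ↥(unitaryGroupOfForm σ ((StdForm.antidiagonal 3).over K))) : GL (Fin 3) K) ∈ (glInt 3 K).map (MulAut.conj g₁).toMonoidHom) →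
        (∀ g : G, g ∈ CI ↔ ((eU g : ↥(unitaryGroupOfForm σ ((StdForm.antidiagonal 3).over K))) : GL (Fin 3) K) ∈ glInt 3 K ∧
          ((eU g : ↥(unitaryGroupOfForm σ ((StdForm.antidiagonal 3).over K))) : GL (Fin 3) K) ∈ (glInt 3 K).map (MulAut.conj g₁).toMonoidHom) →
      ∀ (τ γ : G), (((eU τ : ↥(unitaryGroupOfForm σ ((StdForm.antidiagonal 3).over K))) : GL (Fin 3) K) : Matrix (Fin 3) (Fin 3) K) = Matrix.diagonal ![ϖ⁻¹, 1, σ ϖ] →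
      ∀ {e : Fin 3 → K}, (((eU γ : ↥(unitaryGroupOfForm σ ((StdForm.antidiagonal 3).over K))) : GL (Fin 3) K) : Matrix (Fin 3) (Fin 3) K) = Matrix.diagonal e →
      ∀ {c : ℤ}, Valued.v (e 0) = Valued.v (ϖ ^ c) → Valued.v (e 1) = 1 → Valued.v (e 2) = Valued.v (ϖ ^ (-c)) →
      ∀ (hτγ : τ * γ = γ * τ),
        Finite (Quotient ((orbitRel (Subgroup.zpowers (⟨τ, Subgroup.mem_centralizer_singleton_iff.2 hτγ⟩ : Subgroup.centralizer ({γ} : Set G))) (G ⧸ CA)).comap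
          (Subtype.val : ↥(fixedBy (G ⧸ CA) γ) → G ⧸ CA))) →
        Finite (Quotient ((orbitRel (Subgroup.zpowers (⟨τ, Subgroup.mem_centralizer_singleton_iff.2 hτγ⟩ : Subgroup.centralizer ({γ} : Set G))) (G ⧸ CB)).comap
          (Subtype.val : ↥(fixedBy (G ⧸ CB) γ) → G ⧸ CB))) →
        Nat.card (Quotient ((orbitRel (Subgroup.zpowers (⟨τ, Subgroup.mem_centralizer_singleton_iff.2 hτγ⟩ : Subgroup.centralizer ({γ} : Set G))) (G ⧸ CA)).comap
            (Subtype.val : ↥(fixedBy (G ⧸ CA) γ) → G ⧸ CA))) +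
          Nat.card (Quotient ((orbitRel (Subgroup.zpowers (⟨τ, Subgroup.mem_centralizer_singleton_iff.2 hτγ⟩ : Subgroup.centralizer ({γ} : Set G))) (G ⧸ CB)).comap
            (Subtype.val : ↥(fixedBy (G ⧸ CB) γ) → G ⧸ CB))) =
          Nat.card (Quotient ((orbitRel (Subgroup.zpowers (⟨τ, Subgroup.mem_centralizer_singleton_iff.2 hτγ⟩ : Subgroup.centralizer ({γ} : Set G))) (G ⧸ CI)).comap
            (Subtype.val : ↥(fixedBy (G ⧸ CI) γ) → G ⧸ CI))) :=
  by
  intro K _ _ _ _ _ _ σ ϖ d t hD g₁ hg₁ G _ eU CA CB CI hCA hCB hCI τ γ hτm e hγm c he₀ he₁ he₂ hτγ hfinA hfinB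
  exact natCard_quotient_fixedBy_add_eq_natCard_quotient_fixedBy_inf_three_of_ramified hD.1 hD.2.1 hD.2.2.1 hD.2.2.2.1 hD.2.2.2.2.1 hD.2.2.2.2.2.1 hD.2.2.2.2.2.2
    g₁ hg₁ eU CA CB CI hCA hCB hCI τ γ hτm hγm he₀ he₁ he₂ hτγ hfinA hfinB

end Wild

end Literature.NumberTheory.Automorphic.UnitaryLatticeTree

end
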